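import Mathlib.MeasureTheory.Integral.Bochner.Set
import Mathlib.MeasureTheory.Integral.IntervalIntegral.Basic
import Mathlib.Topology.Order.Compact
import Mathlib.Analysis.SpecialFunctions.Pow.Real
import HarnessLib

/-!
# Selecting a well-spaced set of large values

Topic `NumberTheory/LFunctions` (Dirichlet-polynomial toolkit, companion of
`DirichletPolynomialMeanValue.lean`).  In large-value arguments one passes from an integral over a
measurable set `𝒰 ⊆ [-T, T]` of a nonnegative continuous function (typically `|A(1+it)|²` for a Dirichlet
polynomial `A`) to a sum over a finite **well-spaced** set of points of `𝒰` (`|t - t'| ≥ 1` for distinct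
`t, t'`, the convention of Matomäki–Radziwiłł, §4: "we say that `𝒯 ⊆ ℝ` is well-spaced if `|t - r| ≥ 1`
for all distinct `t, r ∈ 𝒯`"), to which discrete mean and large value theorems (their Lemmas 7, 8, 9, 11)
apply.  Matomäki–Radziwiłł use it in §8.3: "We then find a well-spaced set `𝒯 ⊆ 𝒰` such that
`∫_𝒰 |Q_{v,H}(1+it) R_{v,H}(1+it)|² dt ≤ 2 ∑_{t ∈ 𝒯} |Q_{v,H}(1+it)|² |R_{v,H}(1+it)|²`."

* `Literature.NumberTheory.LFunctions.WellSpaced.exists_wellSpaced_setIntegral_le` — PROVED: for `f ≥ 0` continuous and a measurable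
  `𝒰 ⊆ [-T, T]` there is a finite well-spaced `𝒯 ⊆ 𝒰` with `∫_𝒰 f ≤ 3 ∑_{t ∈ 𝒯} f(t)` (constant `3` in
  place of the printed `2`, immaterial downstream).  Proof: cut `𝒰` by the unit intervals `[k, k+1)`,
  `k ∈ ℤ`; in each nonempty piece pick a point carrying `2/3` of the supremum of `f` there
  (`exists_point_ge`); the pieces have measure `≤ 1`, so `∫_𝒰 f ≤ (3/2) ∑_k f(t_k)`; the points with `k`
  of a fixed parity are well-spaced, and one of the two parity classes carries half the sum.

## References

* K. Matomäki, M. Radziwiłł, *Multiplicative functions in short intervals*, Ann. of Math. (2) 183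
  (2016), §4 (definition of well-spaced sets, before Lemma 7) and §8.3 (arXiv:1501.04585, pp. 11, 17).
* H. Iwaniec, E. Kowalski, *Analytic Number Theory*, AMS Colloquium Publ. 53 (2004), §9.2 (the
  passage from integrals to well-spaced sums in large value estimates) — background only.
-/

noncomputable section

open MeasureTheory Set Finset

namespace Literature.NumberTheory.LFunctions.WellSpaced

/-- On a piece `𝒰 ∩ [k, k+1)` a nonnegative continuous `f` is bounded by its supremum there, and — if the
piece is nonempty — some point of the piece carries at least `2/3` of that supremum. [folklore] -/
theorem exists_point_ge (f : ℝ → ℝ) (hf : Continuous f) (hf0 : ∀ t, 0 ≤ f t) (𝒰 : Set ℝ) (k : ℤ)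
    (hne : (𝒰 ∩ Set.Ico (k : ℝ) (k + 1)).Nonempty) :
    ∃ t ∈ 𝒰 ∩ Set.Ico (k : ℝ) (k + 1),
      ∀ u ∈ 𝒰 ∩ Set.Ico (k : ℝ) (k + 1), f u ≤ (3 / 2) * f t := by
  set S := 𝒰 ∩ Set.Ico (k : ℝ) (k + 1) with hS
  -- `f` is bounded on `[k, k+1]`
  obtain ⟨M, hM⟩ : ∃ M, ∀ u ∈ Set.Icc (k : ℝ) (k + 1), f u ≤ M := by
    obtain ⟨x, -, hx⟩ := (isCompact_Icc (a := (k : ℝ)) (b := (k : ℝ) + 1)).exists_isMaxOn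
      (Set.nonempty_Icc.2 (by linarith)) hf.continuousOn
    exact ⟨f x, fun u hu => hx hu⟩
  have hbdd : BddAbove (f '' S) := ⟨M, by
    rintro _ ⟨u, hu, rfl⟩; exact hM u ⟨hu.2.1, hu.2.2.le⟩⟩
  have hne' : (f '' S).Nonempty := hne.image f
  set s := sSup (f '' S) with hs
  have hsup : ∀ u ∈ S, f u ≤ s := fun u hu => le_csSup hbdd ⟨u, hu, rfl⟩
  have hs0 : 0 ≤ s := by obtain ⟨u, hu⟩ := hne; exact (hf0 u).trans (hsup u hu)
  rcases hs0.eq_or_lt with hzero | hpos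
  · obtain ⟨t, ht⟩ := hne
    refine ⟨t, ht, fun u hu => ?_⟩
    have := hsup u hu; rw [← hzero] at this
    linarith [hf0 t]
  · -- pick `t` with `f t > (2/3) s`
    obtain ⟨_, ⟨t, ht, rfl⟩, hlt⟩ := exists_lt_of_lt_csSup hne' (by linarith : (2 / 3) * s < s)
    refine ⟨t, ht, fun u hu => ?_⟩
    linarith [hsup u hu]

/-- **Selecting well-spaced large values.**  For a nonnegative continuous `f` and a measurable
`𝒰 ⊆ [-T, T]` there is a finite well-spaced (`|t - t'| ≥ 1` for distinct members) set `𝒯 ⊆ 𝒰` with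
`∫_𝒰 f ≤ 3 ∑_{t ∈ 𝒯} f(t)`.  (Cut `𝒰` by the unit intervals `[k, k+1)`, pick in each nonempty piece a point
carrying `2/3` of the supremum, and keep the better of the two parity classes of `k`.)  This is the step
"we then find a well-spaced set `𝒯 ⊆ 𝒰` such that `∫_𝒰 |QR|² ≤ 2 ∑_{t∈𝒯} |QR|²`" of Matomäki–Radziwiłł,
§8.3 (with `3` for `2`). [cite: MatomakiRadziwillAnnals2016, §8.3] -/
theorem exists_wellSpaced_setIntegral_le (f : ℝ → ℝ) (hf : Continuous f) (hf0 : ∀ t, 0 ≤ f t) {T : ℝ}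
    {𝒰 : Set ℝ} (h𝒰 : MeasurableSet 𝒰) (h𝒰T : 𝒰 ⊆ Set.Icc (-T) T) :
    ∃ 𝒯 : Finset ℝ, (↑𝒯 : Set ℝ) ⊆ 𝒰 ∧ (∀ t ∈ 𝒯, ∀ t' ∈ 𝒯, t ≠ t' → 1 ≤ |t - t'|) ∧
      ∫ t in 𝒰, f t ≤ 3 * ∑ t ∈ 𝒯, f t := by
  classical
  -- the pieces
  set K : Finset ℤ := Finset.Icc ⌊-T⌋ ⌈T⌉ with hK
  set U : ℤ → Set ℝ := fun k => 𝒰 ∩ Set.Ico (k : ℝ) (k + 1) with hU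
  have hUmeas : ∀ k, MeasurableSet (U k) := fun k => h𝒰.inter measurableSet_Ico
  have hUdisj : Set.PairwiseDisjoint (↑K : Set ℤ) U := by
    intro k _ k' _ hkk'
    refine Set.disjoint_left.2 fun t ht ht' => hkk' ?_
    have h1 : (k : ℝ) ≤ t ∧ t < k + 1 := ht.2
    have h2 : (k' : ℝ) ≤ t ∧ t < k' + 1 := ht'.2
    have : (k : ℝ) < k' + 1 := by linarith
    have : (k' : ℝ) < k + 1 := by linarith
    have h3 : k < k' + 1 := by exact_mod_cast ‹(k : ℝ) < k' + 1›
    have h4 : k' < k + 1 := by exact_mod_cast ‹(k' : ℝ) < k + 1›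
    omega
  have hcover : 𝒰 = ⋃ k ∈ K, U k := by
    ext t
    simp only [Set.mem_iUnion, hU, Set.mem_inter_iff, Set.mem_Ico, exists_prop]
    constructor
    · intro ht
      have htT := h𝒰T ht
      refine ⟨⌊t⌋, ?_, ht, Int.floor_le t, Int.lt_floor_add_one t⟩
      rw [hK, Finset.mem_Icc]
      exact ⟨Int.floor_mono htT.1, (Int.floor_le_ceil t).trans (Int.ceil_mono htT.2)⟩
    · rintro ⟨k, -, ht, -, -⟩; exact ht
  -- integrability of `f` on `𝒰`
  have hint : IntegrableOn f 𝒰 :=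
    (hf.continuousOn.integrableOn_compact isCompact_Icc).mono_set h𝒰T
  -- the selected points and values
  have hsel : ∀ k : ℤ, ∃ t : ℝ, ((U k).Nonempty → t ∈ U k ∧ ∀ u ∈ U k, f u ≤ (3 / 2) * f t) := by
    intro k
    by_cases hne : (U k).Nonempty
    · obtain ⟨t, ht, h⟩ := exists_point_ge f hf hf0 𝒰 k hne
      exact ⟨t, fun _ => ⟨ht, h⟩⟩
    · exact ⟨0, fun h => absurd h hne⟩
  choose pt hpt using hsel
  set g : ℤ → ℝ := fun k => if (U k).Nonempty then f (pt k) else 0 with hg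
  have hg0 : ∀ k, 0 ≤ g k := fun k => by simp only [hg]; split_ifs <;> simp [hf0]
  -- each piece is controlled by its selected value
  have hpiece : ∀ k ∈ K, ∫ t in U k, f t ≤ (3 / 2) * g k := by
    intro k _
    by_cases hne : (U k).Nonempty
    · obtain ⟨hmem, hle⟩ := hpt k hne
      simp only [hg, if_pos hne]
      have hvol : volume (U k) ≤ 1 := by
        calc volume (U k) ≤ volume (Set.Ico (k : ℝ) (k + 1)) := measure_mono Set.inter_subset_right
          _ = 1 := by rw [Real.volume_Ico]; simp
      have hvol' : (volume (U k)).toReal ≤ 1 := by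
        have := ENNReal.toReal_mono ENNReal.one_ne_top hvol; simpa using this
      calc ∫ t in U k, f t ≤ ∫ t in U k, (3 / 2) * f (pt k) :=
            setIntegral_mono_on (hint.mono_set Set.inter_subset_left) (integrableOn_const ?_) (hUmeas k) hle
        _ = (volume (U k)).toReal * ((3 / 2) * f (pt k)) := by
            rw [setIntegral_const, smul_eq_mul, Measure.real]
        _ ≤ 1 * ((3 / 2) * f (pt k)) :=
            mul_le_mul_of_nonneg_right hvol' (by linarith [hf0 (pt k)])
        _ = (3 / 2) * f (pt k) := one_mul _
      exact (lt_of_le_of_lt (measure_mono Set.inter_subset_right) (by rw [Real.volume_Ico]; simp)).ne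
    · have : U k = ∅ := Set.not_nonempty_iff_eq_empty.1 hne
      rw [this, Measure.restrict_empty, integral_zero_measure]
      linarith [hg0 k]
  -- the integral over `𝒰` is the sum over the pieces
  have hsum : ∫ t in 𝒰, f t = ∑ k ∈ K, ∫ t in U k, f t := by
    rw [hcover]
    exact integral_biUnion_finset K (fun k _ => hUmeas k) hUdisj
      (fun k _ => hint.mono_set (by rw [hcover]; exact Set.subset_biUnion_of_mem (u := U) ‹k ∈ K›))
  -- parity classes
  set Ke := K.filter (fun k => Even k) with hKe
  set Ko := K.filter (fun k => ¬ Even k) with hKo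
  have hsplit : ∑ k ∈ K, g k = ∑ k ∈ Ke, g k + ∑ k ∈ Ko, g k :=
    (Finset.sum_filter_add_sum_filter_not K (fun k => Even k) g).symm
  -- choose the better parity class
  obtain ⟨Kp, hKpK, hKpar, hKp⟩ : ∃ Kp : Finset ℤ, Kp ⊆ K ∧
      (∀ k ∈ Kp, ∀ k' ∈ Kp, k ≠ k' → 2 ≤ |k - k'|) ∧ ∑ k ∈ K, g k ≤ 2 * ∑ k ∈ Kp, g k := by
    have hpar : ∀ {S : Finset ℤ} (P : ℤ → Prop), (∀ k ∈ S, P k) → (∀ k k', P k → P k' → k ≠ k' → 2 ≤ |k - k'|) →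
        ∀ k ∈ S, ∀ k' ∈ S, k ≠ k' → 2 ≤ |k - k'| := fun P hS hP k hk k' hk' hne => hP k k' (hS k hk) (hS k' hk') hne
    have he : ∀ k k' : ℤ, Even k → Even k' → k ≠ k' → 2 ≤ |k - k'| := by
      intro k k' hk hk' hne
      obtain ⟨m, rfl⟩ := hk; obtain ⟨m', rfl⟩ := hk'
      rw [show m + m - (m' + m') = 2 * (m - m') by ring, abs_mul, abs_two]
      have : m ≠ m' := fun h => hne (by rw [h])
      have : 1 ≤ |m - m'| := Int.one_le_abs (sub_ne_zero.2 this)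
      linarith
    have ho : ∀ k k' : ℤ, ¬ Even k → ¬ Even k' → k ≠ k' → 2 ≤ |k - k'| := by
      intro k k' hk hk' hne
      rw [Int.not_even_iff_odd] at hk hk'
      obtain ⟨m, rfl⟩ := hk; obtain ⟨m', rfl⟩ := hk'
      rw [show 2 * m + 1 - (2 * m' + 1) = 2 * (m - m') by ring, abs_mul, abs_two]
      have : m ≠ m' := fun h => hne (by rw [h])
      have : 1 ≤ |m - m'| := Int.one_le_abs (sub_ne_zero.2 this)
      linarith
    have hge0 : 0 ≤ ∑ k ∈ Ke, g k := Finset.sum_nonneg fun k _ => hg0 k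
    have hgo0 : 0 ≤ ∑ k ∈ Ko, g k := Finset.sum_nonneg fun k _ => hg0 k
    rcases le_or_gt (∑ k ∈ Ko, g k) (∑ k ∈ Ke, g k) with h | h
    · refine ⟨Ke, Finset.filter_subset _ _, hpar (fun k => Even k) (fun k hk => (Finset.mem_filter.1 hk).2) he, ?_⟩
      linarith
    · refine ⟨Ko, Finset.filter_subset _ _, hpar (fun k => ¬ Even k) (fun k hk => (Finset.mem_filter.1 hk).2) ho, ?_⟩
      linarith
  -- the well-spaced set
  set Kp' := Kp.filter (fun k => (U k).Nonempty) with hKp'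
  refine ⟨Kp'.image pt, ?_, ?_, ?_⟩
  · intro t ht
    rw [Finset.coe_image] at ht
    obtain ⟨k, hk, rfl⟩ := ht
    have hk' := (Finset.mem_filter.1 (Finset.mem_coe.1 hk)).2
    exact ((hpt k hk').1).1
  · intro t ht t' ht' hne
    rw [Finset.mem_image] at ht ht'
    obtain ⟨k, hk, rfl⟩ := ht
    obtain ⟨k', hk', rfl⟩ := ht'
    have hkU := (hpt k (Finset.mem_filter.1 hk).2).1
    have hk'U := (hpt k' (Finset.mem_filter.1 hk').2).1
    have hkk' : k ≠ k' := fun h => hne (by rw [h])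
    have h2 := hKpar k (Finset.mem_filter.1 hk).1 k' (Finset.mem_filter.1 hk').1 hkk'
    have a1 : (k : ℝ) ≤ pt k ∧ pt k < k + 1 := hkU.2
    have a2 : (k' : ℝ) ≤ pt k' ∧ pt k' < k' + 1 := hk'U.2
    have h2' : (2 : ℝ) ≤ |(k : ℝ) - k'| := by exact_mod_cast h2
    rcases le_or_gt k k' with hle | hle
    · have : (k : ℝ) ≤ k' := by exact_mod_cast hle
      rw [abs_of_nonpos (by linarith)] at h2'
      rw [abs_of_nonpos (by linarith)]
      linarith
    · have : (k' : ℝ) + 1 ≤ k := by exact_mod_cast hle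
      rw [abs_of_nonneg (by linarith)] at h2'
      rw [abs_of_nonneg (by linarith)]
      linarith
  · -- the integral bound
    have hinj : Set.InjOn pt ↑Kp' := by
      intro k hk k' hk' h
      by_contra hkk'
      have hkU := (hpt k (Finset.mem_filter.1 (Finset.mem_coe.1 hk)).2).1
      have hk'U := (hpt k' (Finset.mem_filter.1 (Finset.mem_coe.1 hk')).2).1
      have a1 : (k : ℝ) ≤ pt k ∧ pt k < k + 1 := hkU.2
      have a2 : (k' : ℝ) ≤ pt k' ∧ pt k' < k' + 1 := hk'U.2
      rw [h] at a1
      have : (k : ℝ) < k' + 1 := by linarith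
      have : (k' : ℝ) < k + 1 := by linarith
      have h3 : k < k' + 1 := by exact_mod_cast ‹(k : ℝ) < k' + 1›
      have h4 : k' < k + 1 := by exact_mod_cast ‹(k' : ℝ) < k + 1›
      exact hkk' (by omega)
    rw [Finset.sum_image hinj]
    have hgsum : ∑ k ∈ Kp, g k = ∑ k ∈ Kp', f (pt k) := by
      rw [hKp', Finset.sum_filter]
    calc ∫ t in 𝒰, f t = ∑ k ∈ K, ∫ t in U k, f t := hsum
      _ ≤ ∑ k ∈ K, (3 / 2) * g k := Finset.sum_le_sum hpiece
      _ = (3 / 2) * ∑ k ∈ K, g k := (Finset.mul_sum _ _ _).symm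
      _ ≤ (3 / 2) * (2 * ∑ k ∈ Kp, g k) := mul_le_mul_of_nonneg_left hKp (by norm_num)
      _ = 3 * ∑ k ∈ Kp', f (pt k) := by rw [hgsum]; ring_nf


end Literature.NumberTheory.LFunctions.WellSpaced
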